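import Literature.MathematicalPhysics.QuantumLattice.FreeFermiGasNoPairFieldLRO
import HarnessLib

/-!
# Pair-mode blocks: the pseudo-spin block bound `⟨b_P† b_P⟩ ≤ |P|²/4 + |P|`

pub-hubbard r3 — rung 0′ of the R4 ceiling ladder (R4-MEMO §9.10). HONEST FRAMING: ladder R1–R4
with certified numbers; no claim on H/H₀. NEW cell-side mathematics (not a published result), staged
by the r3 planner seat for a prover/librarian seat. Part 1 of 4 of the `d`-wave kinematic
ceiling `limsup_L L⁻⁴ sup_ψ ⟨Δ_d†Δ_d⟩_ψ ≤ 128/π⁴` (parts: `PairModeBlocks` → `PairOperatorBinnedBound`;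
`DWaveFormFactorSum`; → `DWavePairFieldKinematicCeiling`).

For the hard-core bosons `b_k = c_{-k↓} c_{k↑}` of `ReducedBCSTorus` (`pairMode`):

* `pairOcc k = b_k† b_k`, `pairHole k = b_k b_k†`, `pairBlocked k = 1 - pairOcc k - pairHole k`
  (`= (n_{k↑} - n_{-k↓})²`) and their idempotent / orthogonality algebra;
* `twoMode_identity` (`k ≠ l`): `n^p_k h_l + n^p_l h_k - (b_k†b_l + b_l†b_k) = A†A`,
  `A = b_k h_l - b_l h_k` — the operator form of `¼ - s⃗_k·s⃗_l ≥ 0` for two pseudo-spins;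
* the real expectation functional `reExp A ψ = Re⟨ψ, Aψ⟩` and its order properties;
* **block bound** `reExp_blockPair_le`: `Re⟨ψ, b_P† b_P ψ⟩ ≤ (|P|²/4 + |P|) ⟨ψ,ψ⟩`,
  `b_P = Σ_{k∈P} b_k` — the pseudo-spin Casimir bound `S⁺S⁻ ≤ (m/2)(m/2+1)` made elementary
  (sum the two-mode inequalities over ordered pairs and use `n^p(m - N^p) ≤ m²/4`).
-/

namespace Summit.HubbardSuperconductivity.HubbardLadder

open Matrix Finset Literature.Probability.LatticeModels Literature.MathematicalPhysics.QuantumLattice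
open scoped ComplexOrder ComplexConjugate

variable {L : ℕ} [NeZero L]

/-- shorthand for the operator algebra on the fermionic torus -/
abbrev TorusOp (L : ℕ) [NeZero L] :=
  Matrix (Finset (Orb (FermionTorus 2 L))) (Finset (Orb (FermionTorus 2 L))) ℂ

/-- `n^p_k = b_k† b_k`: the pair level `(k↑,-k↓)` is doubly occupied. [folklore] -/
noncomputable def pairOcc (k : TorusSite 2 L) : TorusOp L := (pairMode k)ᴴ * pairMode k

/-- `h_k = b_k b_k†`: the pair level `(k↑,-k↓)` is empty. [folklore] -/
noncomputable def pairHole (k : TorusSite 2 L) : TorusOp L := pairMode k * (pairMode k)ᴴ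

/-- `D_k = 1 - n^p_k - h_k`: the pair level is singly occupied ("blocked"). [folklore] -/
noncomputable def pairBlocked (k : TorusSite 2 L) : TorusOp L := 1 - pairOcc k - pairHole k

/-- `n^p_k = n_{k↑} n_{-k↓}` (tree lemma `conjTranspose_pairMode_mul_self`). -/
theorem pairOcc_eq (k : TorusSite 2 L) :
    pairOcc k = momentumNumber k 0 * momentumNumber (-k) 1 :=
  conjTranspose_pairMode_mul_self k

/-- `(n_{k↑} + n_{-k↓}) b_k = 0`. [folklore] -/
theorem momentumNumber_add_mul_pairMode (k : TorusSite 2 L) :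
    (momentumNumber k 0 + momentumNumber (-k) 1) * pairMode k = 0 := by
  have h : ¬ (k = -k ∧ (0 : Fin 2) = 1) := fun h => absurd h.2 (by decide)
  rw [Matrix.add_mul, pairMode, ← Matrix.mul_assoc, ← Matrix.mul_assoc,
    momentumNumber_mul_momentumAnnihilation_of_ne h, momentumNumber_mul_momentumAnnihilation_self,
    Matrix.zero_mul, add_zero, Matrix.mul_assoc, momentumNumber_mul_momentumAnnihilation_self,
    Matrix.mul_zero]

/-- `h_k = n^p_k + 1 - (n_{k↑} + n_{-k↓})` (the hard-core boson commutator). [folklore] -/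
theorem pairHole_eq (k : TorusSite 2 L) :
    pairHole k = pairOcc k + (1 - momentumNumber k 0 - momentumNumber (-k) 1) := by
  have h := pairMode_commutator_conjTranspose k k
  rw [if_pos rfl] at h
  rw [pairHole, pairOcc, ← h]
  abel

/-- `D_k = n_{k↑} + n_{-k↓} - 2 n^p_k`. [folklore] -/
theorem pairBlocked_eq (k : TorusSite 2 L) :
    pairBlocked k = momentumNumber k 0 + momentumNumber (-k) 1 - 2 • pairOcc k := by
  rw [pairBlocked, pairHole_eq]
  rw [two_smul]
  abel

/-- `h_k b_k = b_k`. [folklore] -/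
theorem pairHole_mul_pairMode (k : TorusSite 2 L) : pairHole k * pairMode k = pairMode k := by
  rw [pairHole_eq, pairOcc, Matrix.add_mul, Matrix.mul_assoc, pairMode_mul_self, Matrix.mul_zero,
    zero_add, Matrix.sub_mul, Matrix.sub_mul, Matrix.one_mul, sub_sub, ← Matrix.add_mul,
    momentumNumber_add_mul_pairMode, sub_zero]

/-- `h_k` is Hermitian. -/
theorem pairHole_conjTranspose (k : TorusSite 2 L) : (pairHole k)ᴴ = pairHole k := by
  rw [pairHole, conjTranspose_mul, conjTranspose_conjTranspose]

/-- `n^p_k` is Hermitian. -/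
theorem pairOcc_conjTranspose (k : TorusSite 2 L) : (pairOcc k)ᴴ = pairOcc k := by
  rw [pairOcc, conjTranspose_mul, conjTranspose_conjTranspose]

/-- `b_k† h_k = b_k†`. [folklore] -/
theorem conjTranspose_pairMode_mul_pairHole (k : TorusSite 2 L) :
    (pairMode k)ᴴ * pairHole k = (pairMode k)ᴴ := by
  have h := congrArg conjTranspose (pairHole_mul_pairMode k)
  rwa [conjTranspose_mul, pairHole_conjTranspose] at h

/-- `h_k h_k = h_k`. [folklore] -/
theorem pairHole_mul_self (k : TorusSite 2 L) : pairHole k * pairHole k = pairHole k := by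
  conv_lhs => arg 2; rw [pairHole]
  rw [← Matrix.mul_assoc, pairHole_mul_pairMode, pairHole]

/-- `n^p_k n^p_k = n^p_k`. [folklore] -/
theorem pairOcc_mul_self (k : TorusSite 2 L) : pairOcc k * pairOcc k = pairOcc k := by
  rw [pairOcc, Matrix.mul_assoc, ← Matrix.mul_assoc (pairMode k) ((pairMode k)ᴴ), ← pairHole,
    pairHole_mul_pairMode]

/-- `n^p_k h_k = 0`. [folklore] -/
theorem pairOcc_mul_pairHole (k : TorusSite 2 L) : pairOcc k * pairHole k = 0 := by
  rw [pairOcc, pairHole, Matrix.mul_assoc, ← Matrix.mul_assoc (pairMode k) (pairMode k),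
    pairMode_mul_self, Matrix.zero_mul, Matrix.mul_zero]

/-- For `k ≠ l`, `b_k` commutes with `b_l†`. [folklore] -/
theorem pairMode_mul_conjTranspose_of_ne {k l : TorusSite 2 L} (h : k ≠ l) :
    pairMode k * (pairMode l)ᴴ = (pairMode l)ᴴ * pairMode k := by
  have hc := pairMode_commutator_conjTranspose k l
  rw [if_neg h] at hc
  exact sub_eq_zero.1 hc

/-- For `k ≠ l`, `b_k h_l = h_l b_k`. [folklore] -/
theorem pairMode_mul_pairHole_of_ne {k l : TorusSite 2 L} (h : k ≠ l) :
    pairMode k * pairHole l = pairHole l * pairMode k := by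
  rw [pairHole, ← Matrix.mul_assoc, pairMode_comm k l, Matrix.mul_assoc,
    pairMode_mul_conjTranspose_of_ne h, ← Matrix.mul_assoc]

/-- For `k ≠ l`, `b_k† h_l = h_l b_k†`. [folklore] -/
theorem conjTranspose_pairMode_mul_pairHole_of_ne {k l : TorusSite 2 L} (h : k ≠ l) :
    (pairMode k)ᴴ * pairHole l = pairHole l * (pairMode k)ᴴ := by
  have h1 := congrArg conjTranspose (pairMode_mul_pairHole_of_ne h)
  rw [conjTranspose_mul, conjTranspose_mul, pairHole_conjTranspose] at h1
  exact h1.symm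

/-- Left-commutation helper: `A (B C) = B (A C)` when `A B = B A`. -/
private theorem mul_left_comm_of {A B : TorusOp L} (h : A * B = B * A) (C : TorusOp L) :
    A * (B * C) = B * (A * C) := by
  rw [← Matrix.mul_assoc, h, Matrix.mul_assoc]

/-- **Two-mode identity** (`¼ - s⃗_k·s⃗_l = A†A ⊕ …` for two pseudo-spins): for `k ≠ l`,
`n^p_k h_l + n^p_l h_k - (b_k† b_l + b_l† b_k) = A† A` with `A = b_k h_l - b_l h_k`. [folklore] -/
theorem twoMode_identity {k l : TorusSite 2 L} (h : k ≠ l) :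
    (pairMode k * pairHole l - pairMode l * pairHole k)ᴴ *
        (pairMode k * pairHole l - pairMode l * pairHole k) =
      pairOcc k * pairHole l + pairOcc l * pairHole k -
        ((pairMode k)ᴴ * pairMode l + (pairMode l)ᴴ * pairMode k) := by
  have hkl := h
  have hlk : l ≠ k := fun e => h e.symm
  -- commutation facts (`k ≠ l`)
  have c1 : pairHole l * (pairMode k)ᴴ = (pairMode k)ᴴ * pairHole l :=
    (conjTranspose_pairMode_mul_pairHole_of_ne hkl).symm
  have c2 : pairHole l * pairMode k = pairMode k * pairHole l := (pairMode_mul_pairHole_of_ne hkl).symm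
  have c3 : pairHole k * (pairMode l)ᴴ = (pairMode l)ᴴ * pairHole k :=
    (conjTranspose_pairMode_mul_pairHole_of_ne hlk).symm
  have c4 : pairHole k * pairMode l = pairMode l * pairHole k := (pairMode_mul_pairHole_of_ne hlk).symm
  -- the four products
  have t1 : pairHole l * (pairMode k)ᴴ * (pairMode k * pairHole l) = pairOcc k * pairHole l := by
    rw [Matrix.mul_assoc, mul_left_comm_of c1, mul_left_comm_of c2, pairHole_mul_self, pairOcc,
      Matrix.mul_assoc]
  have t4 : pairHole k * (pairMode l)ᴴ * (pairMode l * pairHole k) = pairOcc l * pairHole k := by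
    rw [Matrix.mul_assoc, mul_left_comm_of c3, mul_left_comm_of c4, pairHole_mul_self, pairOcc,
      Matrix.mul_assoc]
  have t2 : pairHole l * (pairMode k)ᴴ * (pairMode l * pairHole k) = (pairMode k)ᴴ * pairMode l := by
    rw [Matrix.mul_assoc, mul_left_comm_of c1, ← Matrix.mul_assoc (pairHole l) (pairMode l),
      pairHole_mul_pairMode, ← c4, ← Matrix.mul_assoc, conjTranspose_pairMode_mul_pairHole]
  have t3 : pairHole k * (pairMode l)ᴴ * (pairMode k * pairHole l) = (pairMode l)ᴴ * pairMode k := by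
    rw [Matrix.mul_assoc, mul_left_comm_of c3, ← Matrix.mul_assoc (pairHole k) (pairMode k),
      pairHole_mul_pairMode, ← c2, ← Matrix.mul_assoc, conjTranspose_pairMode_mul_pairHole]
  rw [conjTranspose_sub, conjTranspose_mul, conjTranspose_mul, pairHole_conjTranspose,
    pairHole_conjTranspose, Matrix.sub_mul, Matrix.mul_sub, Matrix.mul_sub, t1, t2, t3, t4]
  abel

/-! ### Positivity of the pieces -/

/-- `D_k = (n_{k↑} - n_{-k↓})ᴴ (n_{k↑} - n_{-k↓})`. [folklore] -/
theorem pairBlocked_eq_conjTranspose_mul_self (k : TorusSite 2 L) :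
    pairBlocked k = (momentumNumber k 0 - momentumNumber (-k) 1)ᴴ *
      (momentumNumber k 0 - momentumNumber (-k) 1) := by
  have hc : momentumNumber (-k) 1 * momentumNumber k 0 = momentumNumber k 0 * momentumNumber (-k) 1 :=
    (momentumNumber_commute (-k) k 1 0).eq
  rw [conjTranspose_sub, momentumNumber_conjTranspose, momentumNumber_conjTranspose, Matrix.sub_mul,
    Matrix.mul_sub, Matrix.mul_sub, momentumNumber_mul_self, momentumNumber_mul_self, hc,
    pairBlocked_eq, pairOcc_eq, two_smul]
  abel

/-- The blocked projector is positive semidefinite. -/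
theorem posSemidef_pairBlocked (k : TorusSite 2 L) : (pairBlocked k).PosSemidef := by
  rw [pairBlocked_eq_conjTranspose_mul_self]
  exact posSemidef_conjTranspose_mul_self _

/-- `h_k = b_k b_k† ≥ 0`. -/
theorem posSemidef_pairHole (k : TorusSite 2 L) : (pairHole k).PosSemidef := by
  have h : pairHole k = ((pairMode k)ᴴ)ᴴ * (pairMode k)ᴴ := by rw [conjTranspose_conjTranspose, pairHole]
  rw [h]
  exact posSemidef_conjTranspose_mul_self _

/-- `n^p_k = b_k† b_k ≥ 0`. -/
theorem posSemidef_pairOcc (k : TorusSite 2 L) : (pairOcc k).PosSemidef :=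
  posSemidef_conjTranspose_mul_self _

/-- `h_k = 1 - n^p_k - (blocked)`. -/
theorem pairHole_eq_one_sub (k : TorusSite 2 L) : pairHole k = 1 - pairOcc k - pairBlocked k := by
  rw [pairBlocked]; abel

/-- `n^p_k` commutes with every Bloch occupation number. [folklore] -/
theorem pairOcc_commute_momentumNumber (k l : TorusSite 2 L) (σ : Fin 2) :
    pairOcc k * momentumNumber l σ = momentumNumber l σ * pairOcc k := by
  rw [pairOcc_eq, Matrix.mul_assoc, (momentumNumber_commute (-k) l 1 σ).eq, ← Matrix.mul_assoc,
    (momentumNumber_commute k l 0 σ).eq, Matrix.mul_assoc]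

/-- `n^p_k D_l = (X_l n^p_k)ᴴ (X_l n^p_k)` with `X_l = n_{l↑} - n_{-l↓}`, hence `≥ 0`. [folklore] -/
theorem posSemidef_pairOcc_mul_pairBlocked (k l : TorusSite 2 L) :
    (pairOcc k * pairBlocked l).PosSemidef := by
  set X := momentumNumber l 0 - momentumNumber (-l) 1 with hX
  have hXh : Xᴴ = X := by
    rw [hX, conjTranspose_sub, momentumNumber_conjTranspose, momentumNumber_conjTranspose]
  have hcomm : pairOcc k * X = X * pairOcc k := by
    rw [hX, Matrix.mul_sub, Matrix.sub_mul, pairOcc_commute_momentumNumber,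
      pairOcc_commute_momentumNumber]
  have h : pairOcc k * pairBlocked l = (X * pairOcc k)ᴴ * (X * pairOcc k) := by
    rw [conjTranspose_mul, pairOcc_conjTranspose, hXh, pairBlocked_eq_conjTranspose_mul_self, ← hX,
      hXh]
    calc pairOcc k * (X * X) = pairOcc k * pairOcc k * X * X := by
          rw [pairOcc_mul_self, Matrix.mul_assoc]
      _ = pairOcc k * X * (X * pairOcc k) := by
          rw [Matrix.mul_assoc (pairOcc k) (pairOcc k) X, hcomm, ← Matrix.mul_assoc,
            Matrix.mul_assoc (pairOcc k * X) (pairOcc k) X, hcomm]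
  rw [h]
  exact posSemidef_conjTranspose_mul_self _

/-! ### The real expectation functional `Re ⟨ψ, A ψ⟩` -/

/-- `⟨A x, y⟩ = ⟨x, Aᴴ y⟩` for the pairing `star · ⬝ᵥ ·`. [folklore] -/
theorem star_mulVec_dotProduct_torusOp (A : TorusOp L) (x y : Fock (Orb (FermionTorus 2 L))) :
    star (A *ᵥ x) ⬝ᵥ y = star x ⬝ᵥ (Aᴴ *ᵥ y) := by
  rw [star_mulVec, dotProduct_mulVec]

/-- `Re ⟨ψ, A ψ⟩`. -/
noncomputable def reExp (A : TorusOp L) (ψ : Fock (Orb (FermionTorus 2 L))) : ℝ :=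
  (star ψ ⬝ᵥ (A *ᵥ ψ)).re

section reExp
variable (ψ : Fock (Orb (FermionTorus 2 L)))

/-- `reExp` is additive in the operator. -/
theorem reExp_add (A B : TorusOp L) : reExp (A + B) ψ = reExp A ψ + reExp B ψ := by
  rw [reExp, reExp, reExp, Matrix.add_mulVec, dotProduct_add, Complex.add_re]

/-- `reExp` respects subtraction of operators. -/
theorem reExp_sub (A B : TorusOp L) : reExp (A - B) ψ = reExp A ψ - reExp B ψ := by
  rw [reExp, reExp, reExp, Matrix.sub_mulVec, dotProduct_sub, Complex.sub_re]

/-- `reExp 0 = 0`. -/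
theorem reExp_zero : reExp (0 : TorusOp L) ψ = 0 := by
  rw [reExp, Matrix.zero_mulVec, dotProduct_zero, Complex.zero_re]

/-- `reExp` is real-homogeneous in the operator. -/
theorem reExp_smul (c : ℝ) (A : TorusOp L) : reExp ((c : ℂ) • A) ψ = c * reExp A ψ := by
  rw [reExp, reExp, Matrix.smul_mulVec, dotProduct_smul, smul_eq_mul, Complex.re_ofReal_mul]

/-- `reExp` of a finite sum of operators. -/
theorem reExp_sum {α : Type*} (s : Finset α) (f : α → TorusOp L) :
    reExp (∑ i ∈ s, f i) ψ = ∑ i ∈ s, reExp (f i) ψ := by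
  classical
  refine Finset.induction_on s ?_ ?_
  · rw [Finset.sum_empty, Finset.sum_empty, reExp_zero]
  · intro a s ha ih
    rw [Finset.sum_insert ha, Finset.sum_insert ha, reExp_add, ih]

/-- A positive semidefinite operator has nonnegative `reExp`. -/
theorem reExp_nonneg_of_posSemidef {A : TorusOp L} (hA : A.PosSemidef) : 0 ≤ reExp A ψ :=
  (Complex.nonneg_iff.1 (hA.dotProduct_mulVec_nonneg ψ)).1

/-- Operator order `A ≤ B` (as `B - A ≥ 0`) gives `reExp A ≤ reExp B`. -/
theorem reExp_le_of_posSemidef_sub {A B : TorusOp L} (h : (B - A).PosSemidef) :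
    reExp A ψ ≤ reExp B ψ := by
  have := reExp_nonneg_of_posSemidef ψ h
  rw [reExp_sub] at this
  linarith

/-- `reExp Aᴴ = reExp A`. -/
theorem reExp_conjTranspose (A : TorusOp L) : reExp Aᴴ ψ = reExp A ψ := by
  rw [reExp, reExp, ← star_mulVec_dotProduct_torusOp, star_dotProduct, Complex.star_def, Complex.conj_re]

/-- `2c·Re⟨ψ,Nψ⟩ - Re⟨ψ,N²ψ⟩ ≤ c²‖ψ‖²` for Hermitian `N` (`‖(N - c)ψ‖² ≥ 0`). [folklore] -/
theorem two_mul_reExp_sub_reExp_sq_le {N : TorusOp L} (hN : Nᴴ = N) (c : ℝ) :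
    2 * c * reExp N ψ - reExp (N * N) ψ ≤ c ^ 2 * reExp 1 ψ := by
  set M : TorusOp L := N - (c : ℂ) • (1 : TorusOp L) with hM
  have hMh : Mᴴ = M := by
    rw [hM, conjTranspose_sub, hN, conjTranspose_smul, conjTranspose_one, Complex.star_def,
      Complex.conj_ofReal]
  have hMM : Mᴴ * M = N * N - (c : ℂ) • N - ((c : ℂ) • N - ((c * c : ℝ) : ℂ) • (1 : TorusOp L)) := by
    rw [hMh, hM, Matrix.sub_mul, Matrix.mul_sub, Matrix.mul_sub, Matrix.smul_mul, Matrix.mul_smul,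
      Matrix.smul_mul, Matrix.one_mul, Matrix.mul_one, Matrix.one_mul, smul_smul, Complex.ofReal_mul]
  have h0 := reExp_nonneg_of_posSemidef ψ (posSemidef_conjTranspose_mul_self M)
  rw [hMM, reExp_sub, reExp_sub, reExp_sub, reExp_smul, reExp_smul] at h0
  nlinarith [h0]

end reExp

/-! ### The block bound -/

section block
variable (ψ : Fock (Orb (FermionTorus 2 L)))

/-- Diagonal term: `Re⟨ψ, n^p_k ψ⟩ ≤ ‖ψ‖²` (`1 - n^p_k = h_k + D_k ≥ 0`). [folklore] -/
theorem reExp_pairOcc_le (k : TorusSite 2 L) : reExp (pairOcc k) ψ ≤ reExp 1 ψ := by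
  refine reExp_le_of_posSemidef_sub ψ ?_
  have h : (1 : TorusOp L) - pairOcc k = pairHole k + pairBlocked k := by
    rw [pairHole_eq_one_sub]; abel
  rw [h]
  exact (posSemidef_pairHole k).add (posSemidef_pairBlocked k)

/-- Off-diagonal pair (`k ≠ l`): `Re⟨b_k†b_l + b_l†b_k⟩ ≤ Re⟨n^p_k h_l + n^p_l h_k⟩`. [folklore] -/
theorem reExp_cross_le {k l : TorusSite 2 L} (h : k ≠ l) :
    reExp ((pairMode k)ᴴ * pairMode l) ψ + reExp ((pairMode l)ᴴ * pairMode k) ψ ≤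
      reExp (pairOcc k * pairHole l) ψ + reExp (pairOcc l * pairHole k) ψ := by
  have h0 := reExp_nonneg_of_posSemidef ψ
    (posSemidef_conjTranspose_mul_self (pairMode k * pairHole l - pairMode l * pairHole k))
  rw [twoMode_identity h, reExp_sub, reExp_add, reExp_add] at h0
  linarith

/-- `Re⟨ψ, n^p_k h_l ψ⟩ ≤ Re⟨ψ, n^p_k ψ⟩ - Re⟨ψ, n^p_k n^p_l ψ⟩` (drop `n^p_k D_l ≥ 0`). [folklore] -/
theorem reExp_pairOcc_mul_pairHole_le (k l : TorusSite 2 L) :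
    reExp (pairOcc k * pairHole l) ψ ≤ reExp (pairOcc k) ψ - reExp (pairOcc k * pairOcc l) ψ := by
  have h0 := reExp_nonneg_of_posSemidef ψ (posSemidef_pairOcc_mul_pairBlocked k l)
  rw [pairHole_eq_one_sub, Matrix.mul_sub, Matrix.mul_sub, Matrix.mul_one, reExp_sub, reExp_sub]
  linarith

/-- `Σ_{k,l∈P} Re⟨ψ, n^p_k h_l ψ⟩ ≤ (|P|²/4) ‖ψ‖²` (`N_p(m - N_p) ≤ m²/4`). [folklore] -/
theorem sum_sum_reExp_pairOcc_mul_pairHole_le (P : Finset (TorusSite 2 L)) :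
    ∑ k ∈ P, ∑ l ∈ P, reExp (pairOcc k * pairHole l) ψ ≤ (P.card : ℝ) ^ 2 / 4 * reExp 1 ψ := by
  set Np : TorusOp L := ∑ k ∈ P, pairOcc k with hNp
  have hNph : Npᴴ = Np := by
    rw [hNp, conjTranspose_sum]
    exact Finset.sum_congr rfl fun k _ => pairOcc_conjTranspose k
  have h1 : ∑ k ∈ P, ∑ l ∈ P, reExp (pairOcc k * pairHole l) ψ ≤
      ∑ k ∈ P, ∑ l ∈ P, (reExp (pairOcc k) ψ - reExp (pairOcc k * pairOcc l) ψ) :=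
    Finset.sum_le_sum fun k _ => Finset.sum_le_sum fun l _ => reExp_pairOcc_mul_pairHole_le ψ k l
  have h2 : ∑ k ∈ P, ∑ l ∈ P, (reExp (pairOcc k) ψ - reExp (pairOcc k * pairOcc l) ψ) =
      (P.card : ℝ) * reExp Np ψ - reExp (Np * Np) ψ := by
    simp only [Finset.sum_sub_distrib, Finset.sum_const, nsmul_eq_mul]
    rw [← Finset.mul_sum, hNp, reExp_sum, Finset.sum_mul_sum, reExp_sum]
    congr 1
    exact Finset.sum_congr rfl fun k _ => (reExp_sum ψ P _).symm
    -- (second summand)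
  have h3 := two_mul_reExp_sub_reExp_sq_le ψ hNph ((P.card : ℝ) / 2)
  have e1 : 2 * ((P.card : ℝ) / 2) = P.card := by ring
  have e2 : ((P.card : ℝ) / 2) ^ 2 = (P.card : ℝ) ^ 2 / 4 := by ring
  rw [e1, e2] at h3
  linarith

/-- **Block bound.** For any finite set `P` of momenta and any state `ψ`,
`Re⟨ψ, b_P† b_P ψ⟩ ≤ (|P|²/4 + |P|) ⟨ψ,ψ⟩`, `b_P = Σ_{k∈P} b_k` — the pseudo-spin Casimir bound
`S⁺S⁻ ≤ S(S+1) ≤ m/2 (m/2 + 1)` made elementary. [folklore] -/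
theorem reExp_blockPair_le (P : Finset (TorusSite 2 L)) :
    reExp ((∑ k ∈ P, pairMode k)ᴴ * ∑ k ∈ P, pairMode k) ψ ≤
      ((P.card : ℝ) ^ 2 / 4 + P.card) * reExp 1 ψ := by
  classical
  have hexp : reExp ((∑ k ∈ P, pairMode k)ᴴ * ∑ k ∈ P, pairMode k) ψ =
      ∑ k ∈ P, ∑ l ∈ P, reExp ((pairMode k)ᴴ * pairMode l) ψ := by
    rw [conjTranspose_sum, Finset.sum_mul_sum, reExp_sum]
    exact Finset.sum_congr rfl fun k _ => reExp_sum ψ P _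
  have hpt : ∀ k ∈ P, ∀ l ∈ P,
      reExp ((pairMode k)ᴴ * pairMode l) ψ + reExp ((pairMode l)ᴴ * pairMode k) ψ ≤
        reExp (pairOcc k * pairHole l) ψ + reExp (pairOcc l * pairHole k) ψ +
          (if k = l then 2 * reExp 1 ψ else 0) := by
    intro k _ l _
    by_cases hkl : k = l
    · subst hkl
      rw [if_pos rfl, pairOcc_mul_pairHole, reExp_zero]
      have := reExp_pairOcc_le ψ k
      rw [pairOcc] at this
      linarith
    · rw [if_neg hkl, add_zero]
      exact reExp_cross_le ψ hkl
  have hsum := Finset.sum_le_sum fun k hk => Finset.sum_le_sum fun l hl => hpt k hk l hl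
  simp only [Finset.sum_add_distrib] at hsum
  have s1 : ∑ k ∈ P, ∑ l ∈ P, reExp ((pairMode l)ᴴ * pairMode k) ψ =
      ∑ k ∈ P, ∑ l ∈ P, reExp ((pairMode k)ᴴ * pairMode l) ψ := Finset.sum_comm
  have s2 : ∑ k ∈ P, ∑ l ∈ P, reExp (pairOcc l * pairHole k) ψ =
      ∑ k ∈ P, ∑ l ∈ P, reExp (pairOcc k * pairHole l) ψ := Finset.sum_comm
  have s3 : ∑ k ∈ P, ∑ l ∈ P, (if k = l then 2 * reExp 1 ψ else 0) = (P.card : ℝ) * (2 * reExp 1 ψ) := by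
    rw [← nsmul_eq_mul, ← Finset.sum_const]
    exact Finset.sum_congr rfl fun k hk => by rw [Finset.sum_ite_eq, if_pos hk]
  rw [s1, s2, s3] at hsum
  have h4 := sum_sum_reExp_pairOcc_mul_pairHole_le ψ P
  rw [hexp]
  linarith

/-- The block bound in norm form: `‖b_P ψ‖² ≤ (|P|²/4 + |P|) ‖ψ‖²`. [folklore] -/
theorem normSq_blockPair_mulVec_le (P : Finset (TorusSite 2 L)) :
    (star ((∑ k ∈ P, pairMode k) *ᵥ ψ) ⬝ᵥ ((∑ k ∈ P, pairMode k) *ᵥ ψ)).re ≤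
      ((P.card : ℝ) ^ 2 / 4 + P.card) * (star ψ ⬝ᵥ ψ).re := by
  have h := reExp_blockPair_le ψ P
  rwa [reExp, reExp, Matrix.one_mulVec, ← Matrix.mulVec_mulVec, ← star_mulVec_dotProduct_torusOp] at h

end block

end Summit.HubbardSuperconductivity.HubbardLadder
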